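import Summits.Ventures.PercRepro.S1TriangleVCount
import Summits.Ventures.PercRepro.S1FourCircuitW2
import Summits.Ventures.PercRepro.S1CellCaps

/-!
# PercRepro — the cell `(8, 25)` of the `q = 4` window, by LEMMAS V and W′ (p2, gen 18)

At `n = 33` LEMMA V gives `s₃ ≤ 121` and LEMMA W′ (`S1FourCircuitW2`) the joint constraint `8·s₄ + 66·s₃ ≤ 32736`,
i.e. `s₄ ≤ ⌊(32736 − 66·s₃)/8⌋` for the ACTUAL triangle count `s₃`. The capped cell inequality
`cellOK10 8 25 s₃ ⌊(32736 − 66·s₃)/8⌋` holds for every `s₃ ≤ 121` (a kernel table of `122` cells; the twin's worst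
ratio is `0.9555` at `s₃ = 121`, `s₄ ≤ 3093` — against `1.0785` with the separate caps `121` / `4092`), so the
`e`-free cores of rank `8` with `33` points satisfy `RLS` at level `4`: the cell `(8, 25)` closes unconditionally.

* `cell_eight_twentyfive_table` — the `122` kernel cells;
* **`c025_core_eight_twentyfive`** — the core of rank `8` with `33` points.
Axioms: standard.
-/

open scoped Matroid

namespace PercRepro

namespace S1

open Set

variable {α : Type}

/-- The cells `(8, 25)` along LEMMA W′'s curve: `cellOK10 8 25 s₃ ⌊(32736 − 66·s₃)/8⌋` for every `s₃ ≤ 121`. -/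
theorem cell_eight_twentyfive_table : ∀ P < 122, cellOK10 8 25 P ((32736 - 66 * P) / 8) = true := by
  decide +kernel

/-- **THE CELL `(8, 25)`**: an `e`-free core of rank `8` with `33` points satisfies `RLS` at level `4`. -/
theorem c025_core_eight_twentyfive (M : Matroid α) [M.Finite] (hR : M.eRank = (8 : ℕ)) (hn : M.E.ncard = 33)
    (hfree : ∀ e ∈ M.E, ∃ A ⊆ M.E \ {e}, e ∉ M.closure A ∧ e ∉ M.closure ((M.E \ {e}) \ A)) :
    ThmN.RLS M 8 4 := by
  have hP : {C : Set α | M.IsCircuit C ∧ C.ncard = 3}.ncard ≤ 121 := by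
    have h := core_ncard_triangles_le_sq_div_nine M hfree
    rw [hn] at h
    exact h.trans (by norm_num)
  have hW := core_eight_mul_ncard_fourCircuits_add_le M hfree
  rw [hn] at hW
  have hS : {C : Set α | M.IsCircuit C ∧ C.ncard = 4}.ncard ≤
      (32736 - 66 * {C : Set α | M.IsCircuit C ∧ C.ncard = 3}.ncard) / 8 := by
    rw [Nat.le_div_iff_mul_le (by norm_num)]
    omega
  exact rls_of_cellOK10 M 8 25 _ _ (by norm_num) hR hn hfree le_rfl hS (by norm_num)
    (cell_eight_twentyfive_table _ (by omega))

end S1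

end PercRepro
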